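import Summits.QuantumFields.YangMills.Theorems.BalabanUVNodesN22W1RelCentredTermDatum214Generated
import Summits.QuantumFields.YangMills.Theorems.BalabanUVNodesRateReadingOfRecord13Co

/-!
# BalabanUVNodes ∕ node N22 = NE9 — THE W1 OBJECT ON THE RELATIVE-DISC CENTRED ROAD (RE-TYPING M1′), MODULE R2ᶜ: THE Co-KEYED TWIN (KEY-RULE-21; binder `Provisos₁₃Core` unchanged) OF R2b §2 AND R2c — N22's conjunct of
# `KeyedRates rr` at the level-selected tuple reading of record KEYED ON THE bg-FREE PROVISO CORE `Stage13Params.Provisos₁₃Core` (the LAST re-key of this leaf)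

Cell `pub-ymgap`, HUMAN RULING D-0062 (Track A), R134 ACCELERATION re-seat `pub-ymgap-dag-n22-c` (strategy s1), file R2ᶜ of the re-typed line.  THEOREMS ONLY.  Imports R2c
`…N22W1RelCentredTermDatum214Generated` (hence R2b `…Keyed` and the θ-level engine of R2 ∕ R2b §1, which carries NO proviso and is used BY NAME) and dag-n22-e's Co edition (KEY-RULE-21: datum `datumOfRecord₁₃Co`, binder `Provisos₁₃Core`) of
the rate reading of record `…RateReadingOfRecord13Co` (`readingOfRecord₁₃Co`, `rateCarriersOfRecord₁₃Co`, `readingOfRecord₁₃Co_bundle_u3`).  `--supports` the K3 item of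
record at filing time as a HELPER (count-neutral; N22 NOT discharged).

WHY (plan g67 ★ CORE-YES, pub-ymgap INBOX l.17420; director-ym №150 SEQUENCING (1)–(5) l.17700; dag-n22-e SEP-TOKEN-MAP § Core edition).  The Stage-13 record's proviso
structure is re-pinned edition by edition (`Provisos₁₃` → `Provisos₁₃Sep` → `Provisos₁₃SepMixed` → …); the rate-side storeys are proviso-FIELD-blind (`hP` enters only as a
binder TYPE and inside `datumOfRecord₁₃<ed> F N θ hP`), so CONSUMER storeys key ONCE on `(hP : θ.Provisos₁₃Core F N)` and the K3 composer applies them at an item tuple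
`(θ, h : θ.Provisos₁₃<ed> F 2)` with `hP := h.toCore` (datum by `rfl`).  THIS FILE is the Co-keyed twin of this seat's two Sep-keyed binder storeys — R2b §2
(`n22_tupleReadingOfRecordSep(On)_relCentredTermDatum_of_n18Below`, free generator `Gn` identified with the datum's) and R2c (`…relCentredTermDatum₀…`, the LITERALLY
GENERATED reading `Gn := fun F θ k ↦ (𝔇 F θ k).Gn₀`) — under the token map `Provisos₁₃Sep ↦ Provisos₁₃Core`, `readingOfRecord₁₃Sep ↦ readingOfRecord₁₃Co`,
`rateCarriersOfRecord₁₃Sep ↦ rateCarriersOfRecord₁₃Co`, decl names `…tupleReadingOfRecordSep(On)… ↦ …tupleReadingOfRecordCo(On)…`; statements = the Sep statements under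
the map, proofs = the Sep proofs verbatim (the engine `n22At_u3OfRecord₁₃_ofRecordAdm_runTowers_toClusterTower_of_n18Below_relCentredTermDatum` is θ-level and shared).

WHAT.  §1 ★ `n22_tupleReadingOfRecordCoOn_relCentredTermDatum_of_n18Below` (guarded by any regime `Rg`) · `n22_tupleReadingOfRecordCo_relCentredTermDatum_of_n18Below`;
§2 ★ `n22_tupleReadingOfRecordCoOn_relCentredTermDatum₀_of_n18Below` · `n22_tupleReadingOfRecordCo_relCentredTermDatum₀_of_n18Below` (at `Gn := (𝔇 F θ k).Gn₀`).
Hypotheses `h18` ∕ `hnum` ∕ `hdata` VERBATIM from R2b ∕ R2c with the proviso token mapped (Core-keyed storeys quantify over more tuples — harmless: all θ-generic).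

HONEST FRAMING.  Re-keying bookkeeping; count-neutral; the per-term schemas at complex coupling are HYPOTHESES ((S-vertex-T′) is NOT PRINTED — the first missing estimate of
row n22 s1); node N18 below is N18's; no inhabitant of `IsDatumOfRecord₁₃CCore` ∕ admissible tuple claimed (K0 OPEN at every edition); nothing of Bałaban's asserted; N22 NOT
discharged; one finite four-torus programme at fixed ε — NOT infinite volume, NOT OS on ℝ⁴, NOT a mass gap, NOT Clay.  0 `sorry`, 0 `def`, standard axioms.

References (TYPES only): [I] = [Balaban1987RG1] (0.23)–(0.25) pp. 256–257, §1 p. 263, (2.9)–(2.10) pp. 266–267, (2.13) p. 268; [II] = [Balaban1988RG2Cluster] (1.41) p. 11,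
(2.9)–(2.15) pp. 14–16, (2.26) p. 17, Lemma 3 p. 20, (2.39)–(2.41) p. 21.
-/

noncomputable section

open scoped Matrix.Norms.L2Operator

namespace YMDAG.N22.W1

open Set Metric
open scoped BigOperators
open Literature.MathematicalPhysics.QuantumFieldTheory.Balaban1983to89
open Literature.MathematicalPhysics.QuantumFieldTheory.Balaban1983to89.T4Continuum
open Literature.MathematicalPhysics.QuantumFieldTheory.Balaban1983to89.T4OutputRate
open Literature.MathematicalPhysics.QuantumFieldTheory.Balaban1983to89.TreeLengthTorus (TPt TDom tsys torusTreeLen torusTreeLen_nonneg)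
open Literature.MathematicalPhysics.QuantumFieldTheory.Balaban1983to89.B12TreeDecay (K₀ K₀_pos)
open Literature.MathematicalPhysics.QuantumFieldTheory.Balaban1983to89.B13Lemma3TorusData (TBond)
open Literature.MathematicalPhysics.QuantumFieldTheory.Balaban1983to89.B13Lemma3TorusTerms (terms weight weight_nonneg)
open Literature.MathematicalPhysics.QuantumFieldTheory.Balaban1983to89.B13Lemma3TorusSocket (Lemma3Numerics)
open Literature.MathematicalPhysics.QuantumFieldTheory.Balaban1983to89.Step (SFConsts)
open Literature.MathematicalPhysics.QuantumFieldTheory.Balaban1983to89.Node00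
  (Stage12Params Stage13Params U3Objects₁₁ U3Letters₁₁ NE2Objects₁₁ NE3Letters₁₁ MatA ιSU prependCoupling)
open Literature.MathematicalPhysics.QuantumFieldTheory.Balaban1983to89.Node00.Sect2 (domSys domCount CPair ofBackgroundC spaceI domSites Setting Residual)
open Literature.MathematicalPhysics.QuantumFieldTheory.Balaban1983to89.Node00.W1
open YMDAG.UVSplit

variable {N : ℕ} [NeZero N]

/-! ## §1 The Core twin of R2b §2: free generator `Gn` identified with the datum's -/

section TupleReading

variable (Gn : (F : T4Family) → (θ : Stage13Params F N) → (k : ℕ) → GenTower (F.P k) (MatA N) θ.τ9.M)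
  (sp : (F : T4Family) → (θ : Stage13Params F N) → (k j : ℕ) → (domSys (F.P k) θ.τ9.M j).Dom → Set (CPair (F.P k) (MatA N)))
  (gauge : (F : T4Family) → (θ : Stage13Params F N) → (k : ℕ) → GaugeField (F.P k) 0 (Node00.SU N) → GaugeField (F.P k) 0 (Node00.SU N) → ℝ)
  (hg : ∀ (F : T4Family) (θ : Stage13Params F N) (k : ℕ) (U U' : GaugeField (F.P k) 0 (Node00.SU N)), 0 ≤ gauge F θ k U U')
  (T₀ : (F : T4Family) → (θ : Stage13Params F N) → (k : ℕ) → GaugeField (F.P (k + 1)) 0 (Node00.SU N) → GaugeField (F.P k) 0 (Node00.SU N))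
  (hT : ∀ (F : T4Family) (θ : Stage13Params F N) (k : ℕ) (U : GaugeField (F.P (k + 1)) 0 (Node00.SU N)),
    (∀ (j : ℕ) (Y : (domSys (F.P (k + 1)) θ.τ9.M j).Dom), ofBackgroundC (ιSU N) U ∈ sp F θ (k + 1) j Y) →
      ∀ (j : ℕ) (X : (domSys (F.P k) θ.τ9.M j).Dom), ofBackgroundC (ιSU N) (T₀ F θ k U) ∈ sp F θ k j X)
  (li : (F : T4Family) → Stage13Params F N → LetterInputs) (ℓ₃ : T4Family → NE3Letters₁₁)
  (ne2 : (F : T4Family) → Stage13Params F N → (ℕ → ℝ) → List (ULoop F) → ℕ → NE2Objects₁₁)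
  (ne1 : (F : T4Family) → Stage13Params F N → (ℕ → ℝ) → List (ULoop F) → NE1pCarriers)
  (ksel : (F : T4Family) → Stage13Params F N → (ℕ → ℝ) → List (ULoop F) → ℕ)
  (Rg : (F : T4Family) → Stage13Params F N → Prop) {G : Type*} [GaugeGroup G]

open Classical in
/-- **N22's CONJUNCT OF `KeyedRates rr` AT THE LEVEL-SELECTED TUPLE READING OF RECORD (CORE-KEYED) ON THE GENERATED ADMISSIBLE RUN TOWERS, FROM THE RELATIVE-DISC CENTRED SCHEMAS AT THE
(2.14) DATUM, GUARDED BY ANY REGIME `Rg`**: for `rr F θ hP g₀ os := rateCarriersOfRecord₁₃Co (readingOfRecord₁₃Co (fun F θ ↦ ReadingData.ofRecordAdm F θ.τ9.M N (runTowers fun k ↦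
toClusterTower (Gn F θ k)) …) ℓ₃ ne2 ne1) F θ hP g₀ os (ksel F θ g₀ os)`: node N18 at the run lengths BELOW the selected one at the same reading + the letter signs (with `li.s = ½`, `li.μ = 1`) +
per `(F, θ, g₀, os)` in the regime ∃(`NeZero θ.τ9.M`, `Sg`, `Rz`, `cs`, `c`, `L`, `NeZero L`, letters `a a₂ a₂′ a₅ a₅′ Aabs r₁ E₀ Mv cA`, a (2.14) term-datum family `𝔇` with
`Gn F θ (ksel …) = 𝔇.Gn`, a CONTINUED family `TFc`, a centre `V`, a domain family `D`): the R2 §2 hypotheses (table inclusion, numerals at `a₅′`, slack, S25, renewal `… ≤ E₀`, open domains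
with the window points and the relative discs of aperture `cA ∈ ]0,1[`, `Mv·((1+cA)γ)² ≤ ½`, `2·Mv·E₀·(1+cA)² ≤ li.A`, `0 < li.r ≤ min(cA,1)`, real-window agreement of `TFc` with `𝔇`,
(S-last-T′), (S-226-T′) for `TFc` and for `V`, (S-vertex-T′) below `ksel`) ⟹ `∀ F θ hP, Rg F θ → θ.Admissible F N → ∀ g₀ os, N22At (rr F θ hP g₀ os).u3` (§1 once per tuple;
`readingOfRecord₁₃Co_bundle_u3`, `rfl`).  ONE conjunct — NOT a closer of `stub_rates13`. [cite: Balaban1988RG2Cluster, (1.41) p.11, (2.9)-(2.15) pp.14-16, (2.26) p.17, Lemma 3 p.20 and (2.39)-(2.41) p.21; Balaban1987RG1, (0.23)-(0.25) pp.256-257, §1 p.263, (2.9)-(2.10) pp.266-267 and (2.13) p.268] -/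
theorem n22_tupleReadingOfRecordCoOn_relCentredTermDatum_of_n18Below
    (h18 : ∀ (F : T4Family) (θ : Stage13Params F N) (hP : θ.Provisos₁₃Core F N), Rg F θ → θ.Admissible F N → ∀ (g₀ : ℕ → ℝ) (os : List (ULoop F)),
      ∀ k' : ℕ, k' < ksel F θ g₀ os → N18At (u3OfRecord₁₃ θ ((ReadingData.ofRecordAdm F θ.τ9.M N (runTowers fun k => toClusterTower (Gn F θ k)) (sp F θ)
        (gauge F θ) (hg F θ) (T₀ F θ) (hT F θ) (li F θ)).u3Objects θ.γ) k'))
    (hnum : ∀ (F : T4Family) (θ : Stage13Params F N), θ.Provisos₁₃Core F N → Rg F θ → θ.Admissible F N →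
      0 < (li F θ).C₀ ∧ 0 < (li F θ).θ₅ ∧ (li F θ).θ₅ < 1 ∧ 0 ≤ (li F θ).C₅ ∧ 2 * (li F θ).C₅ / (1 - (li F θ).θ₅) ≤ (li F θ).C₀ ∧ 0 < (li F θ).A ∧
        (li F θ).μ = 1 ∧ 0 < (li F θ).r ∧ (li F θ).s = (2 : ℝ)⁻¹)
    (hdata : ∀ (F : T4Family) (θ : Stage13Params F N), θ.Provisos₁₃Core F N → Rg F θ → θ.Admissible F N → ∀ (g₀ : ℕ → ℝ) (os : List (ULoop F)),
      ∃ (_ : NeZero θ.τ9.M) (Sg : Setting (MatA N) G) (Rz : Residual (F.P (ksel F θ g₀ os)) (MatA N))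
        (cs : SFConsts) (c : B13.Consts) (L : ℕ) (_ : NeZero L) (a a₂ a₂' a₅ a₅' Aabs r₁ E₀ Mv cA : ℝ)
        (𝔇 : TermData214 c (F.P (ksel F θ g₀ os)) (MatA N) θ.τ9.M L) (TFc : GenTermFun (F.P (ksel F θ g₀ os)) (MatA N) θ.τ9.M L)
        (V : (k' : ℕ) → (domSys (F.P (ksel F θ g₀ os)) θ.τ9.M (k' + 1)).Dom → TermLabel (F.P (ksel F θ g₀ os)) θ.τ9.M k' L →
          OlderTerms (F.P (ksel F θ g₀ os)) (MatA N) θ.τ9.M k' → CPair (F.P (ksel F θ g₀ os)) (MatA N) → ℂ)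
        (D : ℕ → Set ℂ),
        Gn F θ (ksel F θ g₀ os) = 𝔇.Gn ∧
        (∀ (j : ℕ) (Y : (domSys (F.P (ksel F θ g₀ os)) θ.τ9.M j).Dom),
          sp F θ (ksel F θ g₀ os) j Y ⊆ spaceI Sg Rz θ.τ9.M j (domSites (F.P (ksel F θ g₀ os)) θ.τ9.M j Y) cs.α₀ cs.α₁) ∧
        8 ≤ c.L ∧ c.L = L ∧ Lemma3Numerics c θ.τ9.M ((c.L : ℝ) / 2) a a₂ a₂' a₅' Aabs ∧ 0 ≤ c.C3act * c.ε₁ ∧ 0 ≤ r₁ ∧ (li F θ).κ ≤ r₁ ∧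
        r₁ + 2 * (64 * Real.log 162) + 2 ≤ (1 - 8 * c.δ) * ((c.L : ℝ) / 2) * c.κ ∧
        c.C3act * c.ε₁ * Real.exp (5 * r₁ + 1) * K₀ 64 8 * 9 * 64 ≤ 1 ∧
        Real.exp 1 * 9 * 64 * K₀ 64 8 ^ 2 * (c.C3act * c.ε₁) ≤ E₀ ∧
        (∀ (k' : ℕ) (Z : (domSys (F.P (ksel F θ g₀ os)) θ.τ9.M (k' + 1)).Dom), 2 * Real.exp (a₅ * ((Z.1).card : ℝ)) ≤ Real.exp (a₅' * ((Z.1).card : ℝ))) ∧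
        (∀ i, IsOpen (D i)) ∧ (∀ (i : ℕ), ∀ t ∈ Ioc (0 : ℝ) θ.γ, ((t : ℝ) : ℂ) ∈ D i) ∧ (∀ (i : ℕ), ∀ t ∈ Ioc (0 : ℝ) θ.γ, closedBall (t : ℂ) (cA * t) ⊆ D i) ∧
        0 < cA ∧ cA < 1 ∧ 0 < Mv ∧ Mv * ((1 + cA) * θ.γ) ^ 2 ≤ 1 / 2 ∧ 2 * Mv * E₀ * (1 + cA) ^ 2 ≤ (li F θ).A ∧ (li F θ).r ≤ min cA 1 ∧
        (∀ (k' : ℕ) (Z : (domSys (F.P (ksel F θ g₀ os)) θ.τ9.M (k' + 1)).Dom) (t : TermLabel (F.P (ksel F θ g₀ os)) θ.τ9.M k' L) (s : ℝ), s ∈ Ioc (0 : ℝ) θ.γ →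
          ∀ (old : OlderTerms (F.P (ksel F θ g₀ os)) (MatA N) θ.τ9.M k') (φ : CPair (F.P (ksel F θ g₀ os)) (MatA N)),
            TFc k' Z t (s : ℂ) old φ = (𝔇 k').TF Z t (s : ℂ) old φ) ∧
        (∀ k' : ℕ, k' < ksel F θ g₀ os → ∀ old : OlderTerms (F.P (ksel F θ g₀ os)) (MatA N) θ.τ9.M k',
          (∀ (j : Fin (k' + 1)) (Y : (domSys (F.P (ksel F θ g₀ os)) θ.τ9.M j).Dom) (ψ : CPair (F.P (ksel F θ g₀ os)) (MatA N)),
              ψ ∈ spaceI Sg Rz θ.τ9.M j (domSites (F.P (ksel F θ g₀ os)) θ.τ9.M j Y) cs.α₀ cs.α₁ → ‖old j Y ψ‖ ≤ E₀ * Real.exp (-((li F θ).κ * torusTreeLen Y.1))) →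
          ∀ (X : (domSys (F.P (ksel F θ g₀ os)) θ.τ9.M (k' + 1)).Dom) (φ : CPair (F.P (ksel F θ g₀ os)) (MatA N)),
            φ ∈ spaceI Sg Rz θ.τ9.M (k' + 1) (domSites (F.P (ksel F θ g₀ os)) θ.τ9.M (k' + 1) X) cs.α₀ cs.α₁ →
            ∀ (Z : (domSys (F.P (ksel F θ g₀ os)) θ.τ9.M (k' + 1)).Dom), Z.1 ⊆ X.1 → ∀ t ∈ terms L θ.τ9.M Z,
              DifferentiableOn ℂ (fun z => TFc k' Z t z old φ) (D k') ∧
                ∀ z ∈ D k', ‖TFc k' Z t z old φ‖ ≤ weight L θ.τ9.M c Z a t * Real.exp (a₅ * ((Z.1).card : ℝ))) ∧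
        (∀ k' : ℕ, k' < ksel F θ g₀ os → ∀ i : ℕ, i < k' → ∀ (O : Set ℂ), IsOpen O → ∀ u ∈ D k', ∀ cv : ℂ → OlderTerms (F.P (ksel F θ g₀ os)) (MatA N) θ.τ9.M k',
          (∀ (j : Fin (k' + 1)) (Y : (domSys (F.P (ksel F θ g₀ os)) θ.τ9.M j).Dom) (ψ : CPair (F.P (ksel F θ g₀ os)) (MatA N)),
              ψ ∈ spaceI Sg Rz θ.τ9.M j (domSites (F.P (ksel F θ g₀ os)) θ.τ9.M j Y) cs.α₀ cs.α₁ →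
              DifferentiableOn ℂ (fun z => cv z j Y ψ) O ∧ ∀ z ∈ O, ‖cv z j Y ψ‖ ≤ E₀ * Real.exp (-((li F θ).κ * torusTreeLen Y.1))) →
          ∀ (X : (domSys (F.P (ksel F θ g₀ os)) θ.τ9.M (k' + 1)).Dom) (φ : CPair (F.P (ksel F θ g₀ os)) (MatA N)),
            φ ∈ spaceI Sg Rz θ.τ9.M (k' + 1) (domSites (F.P (ksel F θ g₀ os)) θ.τ9.M (k' + 1) X) cs.α₀ cs.α₁ →
            ∀ (Z : (domSys (F.P (ksel F θ g₀ os)) θ.τ9.M (k' + 1)).Dom), Z.1 ⊆ X.1 → ∀ t ∈ terms L θ.τ9.M Z,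
              DifferentiableOn ℂ (fun z => TFc k' Z t u (cv z) φ) O ∧
                ∀ z ∈ O, ‖TFc k' Z t u (cv z) φ‖ ≤ weight L θ.τ9.M c Z a t * Real.exp (a₅ * ((Z.1).card : ℝ))) ∧
        (∀ k' : ℕ, k' < ksel F θ g₀ os → ∀ (O : Set ℂ), IsOpen O → ∀ cv : ℂ → OlderTerms (F.P (ksel F θ g₀ os)) (MatA N) θ.τ9.M k',
          (∀ (j : Fin (k' + 1)) (Y : (domSys (F.P (ksel F θ g₀ os)) θ.τ9.M j).Dom) (ψ : CPair (F.P (ksel F θ g₀ os)) (MatA N)),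
              ψ ∈ spaceI Sg Rz θ.τ9.M j (domSites (F.P (ksel F θ g₀ os)) θ.τ9.M j Y) cs.α₀ cs.α₁ →
              DifferentiableOn ℂ (fun z => cv z j Y ψ) O ∧ ∀ z ∈ O, ‖cv z j Y ψ‖ ≤ E₀ * Real.exp (-((li F θ).κ * torusTreeLen Y.1))) →
          ∀ (X : (domSys (F.P (ksel F θ g₀ os)) θ.τ9.M (k' + 1)).Dom) (φ : CPair (F.P (ksel F θ g₀ os)) (MatA N)),
            φ ∈ spaceI Sg Rz θ.τ9.M (k' + 1) (domSites (F.P (ksel F θ g₀ os)) θ.τ9.M (k' + 1) X) cs.α₀ cs.α₁ →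
            ∀ (Z : (domSys (F.P (ksel F θ g₀ os)) θ.τ9.M (k' + 1)).Dom), Z.1 ⊆ X.1 → ∀ t ∈ terms L θ.τ9.M Z,
              DifferentiableOn ℂ (fun z => V k' Z t (cv z) φ) O ∧ ∀ z ∈ O, ‖V k' Z t (cv z) φ‖ ≤ weight L θ.τ9.M c Z a t * Real.exp (a₅ * ((Z.1).card : ℝ))) ∧
        (∀ k' : ℕ, k' < ksel F θ g₀ os → ∀ old : OlderTerms (F.P (ksel F θ g₀ os)) (MatA N) θ.τ9.M k',
          (∀ (j : Fin (k' + 1)) (Y : (domSys (F.P (ksel F θ g₀ os)) θ.τ9.M j).Dom) (ψ : CPair (F.P (ksel F θ g₀ os)) (MatA N)),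
              ψ ∈ spaceI Sg Rz θ.τ9.M j (domSites (F.P (ksel F θ g₀ os)) θ.τ9.M j Y) cs.α₀ cs.α₁ → ‖old j Y ψ‖ ≤ E₀ * Real.exp (-((li F θ).κ * torusTreeLen Y.1))) →
          ∀ (X : (domSys (F.P (ksel F θ g₀ os)) θ.τ9.M (k' + 1)).Dom) (φ : CPair (F.P (ksel F θ g₀ os)) (MatA N)),
            φ ∈ spaceI Sg Rz θ.τ9.M (k' + 1) (domSites (F.P (ksel F θ g₀ os)) θ.τ9.M (k' + 1) X) cs.α₀ cs.α₁ →
            ∀ (Z : (domSys (F.P (ksel F θ g₀ os)) θ.τ9.M (k' + 1)).Dom), Z.1 ⊆ X.1 → ∀ t ∈ terms L θ.τ9.M Z, ∀ z ∈ D k',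
              ‖TFc k' Z t z old φ - V k' Z t old φ‖ ≤ Mv * ‖z‖ ^ 2 * (weight L θ.τ9.M c Z a t * Real.exp (a₅ * ((Z.1).card : ℝ))))) :
    ∀ (F : T4Family) (θ : Stage13Params F N) (hP : θ.Provisos₁₃Core F N), Rg F θ → θ.Admissible F N → ∀ (g₀ : ℕ → ℝ) (os : List (ULoop F)),
      N22At (rateCarriersOfRecord₁₃Co (readingOfRecord₁₃Co (fun F θ => ReadingData.ofRecordAdm F θ.τ9.M N (runTowers fun k => toClusterTower (Gn F θ k)) (sp F θ)
        (gauge F θ) (hg F θ) (T₀ F θ) (hT F θ) (li F θ)) ℓ₃ ne2 ne1) F θ hP g₀ os (ksel F θ g₀ os)).u3 := by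
  intro F θ hP hRg hθ g₀ os
  obtain ⟨hC₀, hθ5, hθ1, hC5, hC₀', hA, hμ, hr, hs⟩ := hnum F θ hP hRg hθ
  obtain ⟨hMz, Sg, Rz, cs, c, L, hLz, a, a₂, a₂', a₅, a₅', Aabs, r₁, E₀, Mv, cA, 𝔇, TFc, V, D, hGn, hspk, hL, hLc, hN, hA0, hr₁, hκ, hrate, hsmall, hrenew, h2w, hDo, hDw, hDd,
    hc0, hc1, hMv, hMvγ, hAM, hrc, hagree, hlast, hprop, hpropV, hcen⟩ := hdata F θ hP hRg hθ g₀ os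
  rw [readingOfRecord₁₃Co_bundle_u3]
  exact n22At_u3OfRecord₁₃_ofRecordAdm_runTowers_toClusterTower_of_n18Below_relCentredTermDatum θ (Gn F θ) (sp F θ) (gauge F θ) (hg F θ) (T₀ F θ) (hT F θ) (li F θ)
    (ksel F θ g₀ os) c 𝔇 TFc V D Sg Rz hGn hspk hL hLc hN hA0 hr₁ hκ hrate hsmall hrenew h2w hDo hDw hDd hc0 hc1 hMv hMvγ hAM hagree hlast hprop hpropV hcen
    (h18 F θ hP hRg hθ g₀ os) hC5 hθ1 hC₀' hC₀ hθ5 hA hμ hr hrc hθ.toStage9.gamma_pos hs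

open Classical in
/-- **… UNGUARDED** (the skeleton's binder «`∀ F θ hP, θ.Admissible F N → ∀ g₀ os, N22At (rr F θ hP g₀ os).u3`» verbatim: the guarded form at `Rg := fun _ _ ↦ True`).
[cite: Balaban1988RG2Cluster, (2.9)-(2.15) pp.14-16, (2.26) p.17, Lemma 3 p.20 and (2.39)-(2.41) p.21; Balaban1987RG1, (0.23)-(0.25) pp.256-257, §1 p.263 and (2.13) p.268] -/
theorem n22_tupleReadingOfRecordCo_relCentredTermDatum_of_n18Below
    (h18 : ∀ (F : T4Family) (θ : Stage13Params F N) (hP : θ.Provisos₁₃Core F N), θ.Admissible F N → ∀ (g₀ : ℕ → ℝ) (os : List (ULoop F)),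
      ∀ k' : ℕ, k' < ksel F θ g₀ os → N18At (u3OfRecord₁₃ θ ((ReadingData.ofRecordAdm F θ.τ9.M N (runTowers fun k => toClusterTower (Gn F θ k)) (sp F θ)
        (gauge F θ) (hg F θ) (T₀ F θ) (hT F θ) (li F θ)).u3Objects θ.γ) k'))
    (hnum : ∀ (F : T4Family) (θ : Stage13Params F N), θ.Provisos₁₃Core F N → θ.Admissible F N →
      0 < (li F θ).C₀ ∧ 0 < (li F θ).θ₅ ∧ (li F θ).θ₅ < 1 ∧ 0 ≤ (li F θ).C₅ ∧ 2 * (li F θ).C₅ / (1 - (li F θ).θ₅) ≤ (li F θ).C₀ ∧ 0 < (li F θ).A ∧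
        (li F θ).μ = 1 ∧ 0 < (li F θ).r ∧ (li F θ).s = (2 : ℝ)⁻¹)
    (hdata : ∀ (F : T4Family) (θ : Stage13Params F N), θ.Provisos₁₃Core F N → θ.Admissible F N → ∀ (g₀ : ℕ → ℝ) (os : List (ULoop F)),
      ∃ (_ : NeZero θ.τ9.M) (Sg : Setting (MatA N) G) (Rz : Residual (F.P (ksel F θ g₀ os)) (MatA N))
        (cs : SFConsts) (c : B13.Consts) (L : ℕ) (_ : NeZero L) (a a₂ a₂' a₅ a₅' Aabs r₁ E₀ Mv cA : ℝ)
        (𝔇 : TermData214 c (F.P (ksel F θ g₀ os)) (MatA N) θ.τ9.M L) (TFc : GenTermFun (F.P (ksel F θ g₀ os)) (MatA N) θ.τ9.M L)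
        (V : (k' : ℕ) → (domSys (F.P (ksel F θ g₀ os)) θ.τ9.M (k' + 1)).Dom → TermLabel (F.P (ksel F θ g₀ os)) θ.τ9.M k' L →
          OlderTerms (F.P (ksel F θ g₀ os)) (MatA N) θ.τ9.M k' → CPair (F.P (ksel F θ g₀ os)) (MatA N) → ℂ)
        (D : ℕ → Set ℂ),
        Gn F θ (ksel F θ g₀ os) = 𝔇.Gn ∧
        (∀ (j : ℕ) (Y : (domSys (F.P (ksel F θ g₀ os)) θ.τ9.M j).Dom),
          sp F θ (ksel F θ g₀ os) j Y ⊆ spaceI Sg Rz θ.τ9.M j (domSites (F.P (ksel F θ g₀ os)) θ.τ9.M j Y) cs.α₀ cs.α₁) ∧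
        8 ≤ c.L ∧ c.L = L ∧ Lemma3Numerics c θ.τ9.M ((c.L : ℝ) / 2) a a₂ a₂' a₅' Aabs ∧ 0 ≤ c.C3act * c.ε₁ ∧ 0 ≤ r₁ ∧ (li F θ).κ ≤ r₁ ∧
        r₁ + 2 * (64 * Real.log 162) + 2 ≤ (1 - 8 * c.δ) * ((c.L : ℝ) / 2) * c.κ ∧
        c.C3act * c.ε₁ * Real.exp (5 * r₁ + 1) * K₀ 64 8 * 9 * 64 ≤ 1 ∧
        Real.exp 1 * 9 * 64 * K₀ 64 8 ^ 2 * (c.C3act * c.ε₁) ≤ E₀ ∧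
        (∀ (k' : ℕ) (Z : (domSys (F.P (ksel F θ g₀ os)) θ.τ9.M (k' + 1)).Dom), 2 * Real.exp (a₅ * ((Z.1).card : ℝ)) ≤ Real.exp (a₅' * ((Z.1).card : ℝ))) ∧
        (∀ i, IsOpen (D i)) ∧ (∀ (i : ℕ), ∀ t ∈ Ioc (0 : ℝ) θ.γ, ((t : ℝ) : ℂ) ∈ D i) ∧ (∀ (i : ℕ), ∀ t ∈ Ioc (0 : ℝ) θ.γ, closedBall (t : ℂ) (cA * t) ⊆ D i) ∧
        0 < cA ∧ cA < 1 ∧ 0 < Mv ∧ Mv * ((1 + cA) * θ.γ) ^ 2 ≤ 1 / 2 ∧ 2 * Mv * E₀ * (1 + cA) ^ 2 ≤ (li F θ).A ∧ (li F θ).r ≤ min cA 1 ∧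
        (∀ (k' : ℕ) (Z : (domSys (F.P (ksel F θ g₀ os)) θ.τ9.M (k' + 1)).Dom) (t : TermLabel (F.P (ksel F θ g₀ os)) θ.τ9.M k' L) (s : ℝ), s ∈ Ioc (0 : ℝ) θ.γ →
          ∀ (old : OlderTerms (F.P (ksel F θ g₀ os)) (MatA N) θ.τ9.M k') (φ : CPair (F.P (ksel F θ g₀ os)) (MatA N)),
            TFc k' Z t (s : ℂ) old φ = (𝔇 k').TF Z t (s : ℂ) old φ) ∧
        (∀ k' : ℕ, k' < ksel F θ g₀ os → ∀ old : OlderTerms (F.P (ksel F θ g₀ os)) (MatA N) θ.τ9.M k',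
          (∀ (j : Fin (k' + 1)) (Y : (domSys (F.P (ksel F θ g₀ os)) θ.τ9.M j).Dom) (ψ : CPair (F.P (ksel F θ g₀ os)) (MatA N)),
              ψ ∈ spaceI Sg Rz θ.τ9.M j (domSites (F.P (ksel F θ g₀ os)) θ.τ9.M j Y) cs.α₀ cs.α₁ → ‖old j Y ψ‖ ≤ E₀ * Real.exp (-((li F θ).κ * torusTreeLen Y.1))) →
          ∀ (X : (domSys (F.P (ksel F θ g₀ os)) θ.τ9.M (k' + 1)).Dom) (φ : CPair (F.P (ksel F θ g₀ os)) (MatA N)),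
            φ ∈ spaceI Sg Rz θ.τ9.M (k' + 1) (domSites (F.P (ksel F θ g₀ os)) θ.τ9.M (k' + 1) X) cs.α₀ cs.α₁ →
            ∀ (Z : (domSys (F.P (ksel F θ g₀ os)) θ.τ9.M (k' + 1)).Dom), Z.1 ⊆ X.1 → ∀ t ∈ terms L θ.τ9.M Z,
              DifferentiableOn ℂ (fun z => TFc k' Z t z old φ) (D k') ∧
                ∀ z ∈ D k', ‖TFc k' Z t z old φ‖ ≤ weight L θ.τ9.M c Z a t * Real.exp (a₅ * ((Z.1).card : ℝ))) ∧
        (∀ k' : ℕ, k' < ksel F θ g₀ os → ∀ i : ℕ, i < k' → ∀ (O : Set ℂ), IsOpen O → ∀ u ∈ D k', ∀ cv : ℂ → OlderTerms (F.P (ksel F θ g₀ os)) (MatA N) θ.τ9.M k',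
          (∀ (j : Fin (k' + 1)) (Y : (domSys (F.P (ksel F θ g₀ os)) θ.τ9.M j).Dom) (ψ : CPair (F.P (ksel F θ g₀ os)) (MatA N)),
              ψ ∈ spaceI Sg Rz θ.τ9.M j (domSites (F.P (ksel F θ g₀ os)) θ.τ9.M j Y) cs.α₀ cs.α₁ →
              DifferentiableOn ℂ (fun z => cv z j Y ψ) O ∧ ∀ z ∈ O, ‖cv z j Y ψ‖ ≤ E₀ * Real.exp (-((li F θ).κ * torusTreeLen Y.1))) →
          ∀ (X : (domSys (F.P (ksel F θ g₀ os)) θ.τ9.M (k' + 1)).Dom) (φ : CPair (F.P (ksel F θ g₀ os)) (MatA N)),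
            φ ∈ spaceI Sg Rz θ.τ9.M (k' + 1) (domSites (F.P (ksel F θ g₀ os)) θ.τ9.M (k' + 1) X) cs.α₀ cs.α₁ →
            ∀ (Z : (domSys (F.P (ksel F θ g₀ os)) θ.τ9.M (k' + 1)).Dom), Z.1 ⊆ X.1 → ∀ t ∈ terms L θ.τ9.M Z,
              DifferentiableOn ℂ (fun z => TFc k' Z t u (cv z) φ) O ∧
                ∀ z ∈ O, ‖TFc k' Z t u (cv z) φ‖ ≤ weight L θ.τ9.M c Z a t * Real.exp (a₅ * ((Z.1).card : ℝ))) ∧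
        (∀ k' : ℕ, k' < ksel F θ g₀ os → ∀ (O : Set ℂ), IsOpen O → ∀ cv : ℂ → OlderTerms (F.P (ksel F θ g₀ os)) (MatA N) θ.τ9.M k',
          (∀ (j : Fin (k' + 1)) (Y : (domSys (F.P (ksel F θ g₀ os)) θ.τ9.M j).Dom) (ψ : CPair (F.P (ksel F θ g₀ os)) (MatA N)),
              ψ ∈ spaceI Sg Rz θ.τ9.M j (domSites (F.P (ksel F θ g₀ os)) θ.τ9.M j Y) cs.α₀ cs.α₁ →
              DifferentiableOn ℂ (fun z => cv z j Y ψ) O ∧ ∀ z ∈ O, ‖cv z j Y ψ‖ ≤ E₀ * Real.exp (-((li F θ).κ * torusTreeLen Y.1))) →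
          ∀ (X : (domSys (F.P (ksel F θ g₀ os)) θ.τ9.M (k' + 1)).Dom) (φ : CPair (F.P (ksel F θ g₀ os)) (MatA N)),
            φ ∈ spaceI Sg Rz θ.τ9.M (k' + 1) (domSites (F.P (ksel F θ g₀ os)) θ.τ9.M (k' + 1) X) cs.α₀ cs.α₁ →
            ∀ (Z : (domSys (F.P (ksel F θ g₀ os)) θ.τ9.M (k' + 1)).Dom), Z.1 ⊆ X.1 → ∀ t ∈ terms L θ.τ9.M Z,
              DifferentiableOn ℂ (fun z => V k' Z t (cv z) φ) O ∧ ∀ z ∈ O, ‖V k' Z t (cv z) φ‖ ≤ weight L θ.τ9.M c Z a t * Real.exp (a₅ * ((Z.1).card : ℝ))) ∧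
        (∀ k' : ℕ, k' < ksel F θ g₀ os → ∀ old : OlderTerms (F.P (ksel F θ g₀ os)) (MatA N) θ.τ9.M k',
          (∀ (j : Fin (k' + 1)) (Y : (domSys (F.P (ksel F θ g₀ os)) θ.τ9.M j).Dom) (ψ : CPair (F.P (ksel F θ g₀ os)) (MatA N)),
              ψ ∈ spaceI Sg Rz θ.τ9.M j (domSites (F.P (ksel F θ g₀ os)) θ.τ9.M j Y) cs.α₀ cs.α₁ → ‖old j Y ψ‖ ≤ E₀ * Real.exp (-((li F θ).κ * torusTreeLen Y.1))) →
          ∀ (X : (domSys (F.P (ksel F θ g₀ os)) θ.τ9.M (k' + 1)).Dom) (φ : CPair (F.P (ksel F θ g₀ os)) (MatA N)),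
            φ ∈ spaceI Sg Rz θ.τ9.M (k' + 1) (domSites (F.P (ksel F θ g₀ os)) θ.τ9.M (k' + 1) X) cs.α₀ cs.α₁ →
            ∀ (Z : (domSys (F.P (ksel F θ g₀ os)) θ.τ9.M (k' + 1)).Dom), Z.1 ⊆ X.1 → ∀ t ∈ terms L θ.τ9.M Z, ∀ z ∈ D k',
              ‖TFc k' Z t z old φ - V k' Z t old φ‖ ≤ Mv * ‖z‖ ^ 2 * (weight L θ.τ9.M c Z a t * Real.exp (a₅ * ((Z.1).card : ℝ))))) :
    ∀ (F : T4Family) (θ : Stage13Params F N) (hP : θ.Provisos₁₃Core F N), θ.Admissible F N → ∀ (g₀ : ℕ → ℝ) (os : List (ULoop F)),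
      N22At (rateCarriersOfRecord₁₃Co (readingOfRecord₁₃Co (fun F θ => ReadingData.ofRecordAdm F θ.τ9.M N (runTowers fun k => toClusterTower (Gn F θ k)) (sp F θ)
        (gauge F θ) (hg F θ) (T₀ F θ) (hT F θ) (li F θ)) ℓ₃ ne2 ne1) F θ hP g₀ os (ksel F θ g₀ os)).u3 :=
  fun F θ hP hθ g₀ os =>
    n22_tupleReadingOfRecordCoOn_relCentredTermDatum_of_n18Below Gn sp gauge hg T₀ hT li ℓ₃ ne2 ne1 ksel (fun _ _ => True) (G := G)
      (fun F θ hP _ hθ => h18 F θ hP hθ) (fun F θ hP _ hθ => hnum F θ hP hθ) (fun F θ hP _ hθ => hdata F θ hP hθ) F θ hP trivial hθ g₀ os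

end TupleReading

/-! ## §2 The Core twin of R2c: the LITERALLY GENERATED reading `Gn := fun F θ k ↦ (𝔇 F θ k).Gn₀` -/

section Generated

variable (c : (F : T4Family) → Stage13Params F N → ℕ → B13.Consts) (L : (F : T4Family) → Stage13Params F N → ℕ → ℕ) [hL : ∀ F θ k, NeZero (L F θ k)]
  (𝔇 : (F : T4Family) → (θ : Stage13Params F N) → (k : ℕ) → TermData214 (c F θ k) (F.P k) (MatA N) θ.τ9.M (L F θ k))
  (sp : (F : T4Family) → (θ : Stage13Params F N) → (k j : ℕ) → (domSys (F.P k) θ.τ9.M j).Dom → Set (CPair (F.P k) (MatA N)))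
  (gauge : (F : T4Family) → (θ : Stage13Params F N) → (k : ℕ) → GaugeField (F.P k) 0 (Node00.SU N) → GaugeField (F.P k) 0 (Node00.SU N) → ℝ)
  (hg : ∀ (F : T4Family) (θ : Stage13Params F N) (k : ℕ) (U U' : GaugeField (F.P k) 0 (Node00.SU N)), 0 ≤ gauge F θ k U U')
  (T₀ : (F : T4Family) → (θ : Stage13Params F N) → (k : ℕ) → GaugeField (F.P (k + 1)) 0 (Node00.SU N) → GaugeField (F.P k) 0 (Node00.SU N))
  (hT : ∀ (F : T4Family) (θ : Stage13Params F N) (k : ℕ) (U : GaugeField (F.P (k + 1)) 0 (Node00.SU N)),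
    (∀ (j : ℕ) (Y : (domSys (F.P (k + 1)) θ.τ9.M j).Dom), ofBackgroundC (ιSU N) U ∈ sp F θ (k + 1) j Y) →
      ∀ (j : ℕ) (X : (domSys (F.P k) θ.τ9.M j).Dom), ofBackgroundC (ιSU N) (T₀ F θ k U) ∈ sp F θ k j X)
  (li : (F : T4Family) → Stage13Params F N → LetterInputs) (ℓ₃ : T4Family → NE3Letters₁₁)
  (ne2 : (F : T4Family) → Stage13Params F N → (ℕ → ℝ) → List (ULoop F) → ℕ → NE2Objects₁₁)
  (ne1 : (F : T4Family) → Stage13Params F N → (ℕ → ℝ) → List (ULoop F) → NE1pCarriers)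
  (ksel : (F : T4Family) → Stage13Params F N → (ℕ → ℝ) → List (ULoop F) → ℕ)
  (Rg : (F : T4Family) → Stage13Params F N → Prop) {G : Type*} [GaugeGroup G]

open Classical in
/-- **N22's CONJUNCT OF `KeyedRates rr` AT THE LITERALLY GENERATED TUPLE READING OF RECORD (CORE-KEYED), GUARDED BY ANY REGIME `Rg`** — R2b §2 at `Gn := fun F θ k ↦ (𝔇 F θ k).Gn₀`
(W1-9's TOTAL generator of the (2.14) term-datum family of record; the identification `(𝔇 F θ k).Gn₀ = (𝔇 F θ k).Gn` is `TermData214.Gn₀_eq` under the tuple's `NeZero θ.τ9.M`): node N18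
below `ksel` + signs + per `(F, θ, g₀, os)` in the regime ∃(`NeZero θ.τ9.M`, `Sg`, `Rz`, `cs`, letters `a a₂ a₂′ a₅ a₅′ Aabs r₁ E₀ Mv cA`, continued family `TFc`, centre `V`, domain family
`D`): the R2 data for the datum `𝔇 F θ (ksel …)`.  ONE conjunct — NOT a closer of `stub_rates13`.
[cite: Balaban1988RG2Cluster, (1.41) p.11, (2.9)-(2.15) pp.14-16, (2.26) p.17, Lemma 3 p.20 and (2.39)-(2.41) p.21; Balaban1987RG1, (0.23)-(0.25) pp.256-257, §1 p.263, (2.9)-(2.10) pp.266-267 and (2.13) p.268] -/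
theorem n22_tupleReadingOfRecordCoOn_relCentredTermDatum₀_of_n18Below
    (h18 : ∀ (F : T4Family) (θ : Stage13Params F N) (hP : θ.Provisos₁₃Core F N), Rg F θ → θ.Admissible F N → ∀ (g₀ : ℕ → ℝ) (os : List (ULoop F)),
      ∀ k' : ℕ, k' < ksel F θ g₀ os → N18At (u3OfRecord₁₃ θ ((ReadingData.ofRecordAdm F θ.τ9.M N (runTowers fun k => toClusterTower ((𝔇 F θ k).Gn₀)) (sp F θ)
        (gauge F θ) (hg F θ) (T₀ F θ) (hT F θ) (li F θ)).u3Objects θ.γ) k'))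
    (hnum : ∀ (F : T4Family) (θ : Stage13Params F N), θ.Provisos₁₃Core F N → Rg F θ → θ.Admissible F N →
      0 < (li F θ).C₀ ∧ 0 < (li F θ).θ₅ ∧ (li F θ).θ₅ < 1 ∧ 0 ≤ (li F θ).C₅ ∧ 2 * (li F θ).C₅ / (1 - (li F θ).θ₅) ≤ (li F θ).C₀ ∧ 0 < (li F θ).A ∧
        (li F θ).μ = 1 ∧ 0 < (li F θ).r ∧ (li F θ).s = (2 : ℝ)⁻¹)
    (hdata : ∀ (F : T4Family) (θ : Stage13Params F N), θ.Provisos₁₃Core F N → Rg F θ → θ.Admissible F N → ∀ (g₀ : ℕ → ℝ) (os : List (ULoop F)),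
      ∃ (_ : NeZero θ.τ9.M) (Sg : Setting (MatA N) G) (Rz : Residual (F.P (ksel F θ g₀ os)) (MatA N))
        (cs : SFConsts) (a a₂ a₂' a₅ a₅' Aabs r₁ E₀ Mv cA : ℝ) (TFc : GenTermFun (F.P (ksel F θ g₀ os)) (MatA N) θ.τ9.M (L F θ (ksel F θ g₀ os)))
        (V : (k' : ℕ) → (domSys (F.P (ksel F θ g₀ os)) θ.τ9.M (k' + 1)).Dom → TermLabel (F.P (ksel F θ g₀ os)) θ.τ9.M k' (L F θ (ksel F θ g₀ os)) →
          OlderTerms (F.P (ksel F θ g₀ os)) (MatA N) θ.τ9.M k' → CPair (F.P (ksel F θ g₀ os)) (MatA N) → ℂ)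
        (D : ℕ → Set ℂ),
        (∀ (j : ℕ) (Y : (domSys (F.P (ksel F θ g₀ os)) θ.τ9.M j).Dom),
          sp F θ (ksel F θ g₀ os) j Y ⊆ spaceI Sg Rz θ.τ9.M j (domSites (F.P (ksel F θ g₀ os)) θ.τ9.M j Y) cs.α₀ cs.α₁) ∧
        8 ≤ (c F θ (ksel F θ g₀ os)).L ∧ (c F θ (ksel F θ g₀ os)).L = L F θ (ksel F θ g₀ os) ∧
        Lemma3Numerics (c F θ (ksel F θ g₀ os)) θ.τ9.M (((c F θ (ksel F θ g₀ os)).L : ℝ) / 2) a a₂ a₂' a₅' Aabs ∧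
        0 ≤ (c F θ (ksel F θ g₀ os)).C3act * (c F θ (ksel F θ g₀ os)).ε₁ ∧ 0 ≤ r₁ ∧ (li F θ).κ ≤ r₁ ∧
        r₁ + 2 * (64 * Real.log 162) + 2 ≤ (1 - 8 * (c F θ (ksel F θ g₀ os)).δ) * (((c F θ (ksel F θ g₀ os)).L : ℝ) / 2) * (c F θ (ksel F θ g₀ os)).κ ∧
        (c F θ (ksel F θ g₀ os)).C3act * (c F θ (ksel F θ g₀ os)).ε₁ * Real.exp (5 * r₁ + 1) * K₀ 64 8 * 9 * 64 ≤ 1 ∧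
        Real.exp 1 * 9 * 64 * K₀ 64 8 ^ 2 * ((c F θ (ksel F θ g₀ os)).C3act * (c F θ (ksel F θ g₀ os)).ε₁) ≤ E₀ ∧
        (∀ (k' : ℕ) (Z : (domSys (F.P (ksel F θ g₀ os)) θ.τ9.M (k' + 1)).Dom), 2 * Real.exp (a₅ * ((Z.1).card : ℝ)) ≤ Real.exp (a₅' * ((Z.1).card : ℝ))) ∧
        (∀ i, IsOpen (D i)) ∧ (∀ (i : ℕ), ∀ t ∈ Ioc (0 : ℝ) θ.γ, ((t : ℝ) : ℂ) ∈ D i) ∧ (∀ (i : ℕ), ∀ t ∈ Ioc (0 : ℝ) θ.γ, closedBall (t : ℂ) (cA * t) ⊆ D i) ∧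
        0 < cA ∧ cA < 1 ∧ 0 < Mv ∧ Mv * ((1 + cA) * θ.γ) ^ 2 ≤ 1 / 2 ∧ 2 * Mv * E₀ * (1 + cA) ^ 2 ≤ (li F θ).A ∧ (li F θ).r ≤ min cA 1 ∧
        (∀ (k' : ℕ) (Z : (domSys (F.P (ksel F θ g₀ os)) θ.τ9.M (k' + 1)).Dom) (t : TermLabel (F.P (ksel F θ g₀ os)) θ.τ9.M k' (L F θ (ksel F θ g₀ os))) (s : ℝ),
          s ∈ Ioc (0 : ℝ) θ.γ → ∀ (old : OlderTerms (F.P (ksel F θ g₀ os)) (MatA N) θ.τ9.M k') (φ : CPair (F.P (ksel F θ g₀ os)) (MatA N)),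
            TFc k' Z t (s : ℂ) old φ = (𝔇 F θ (ksel F θ g₀ os) k').TF Z t (s : ℂ) old φ) ∧
        (∀ k' : ℕ, k' < ksel F θ g₀ os → ∀ old : OlderTerms (F.P (ksel F θ g₀ os)) (MatA N) θ.τ9.M k',
          (∀ (j : Fin (k' + 1)) (Y : (domSys (F.P (ksel F θ g₀ os)) θ.τ9.M j).Dom) (ψ : CPair (F.P (ksel F θ g₀ os)) (MatA N)),
              ψ ∈ spaceI Sg Rz θ.τ9.M j (domSites (F.P (ksel F θ g₀ os)) θ.τ9.M j Y) cs.α₀ cs.α₁ → ‖old j Y ψ‖ ≤ E₀ * Real.exp (-((li F θ).κ * torusTreeLen Y.1))) →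
          ∀ (X : (domSys (F.P (ksel F θ g₀ os)) θ.τ9.M (k' + 1)).Dom) (φ : CPair (F.P (ksel F θ g₀ os)) (MatA N)),
            φ ∈ spaceI Sg Rz θ.τ9.M (k' + 1) (domSites (F.P (ksel F θ g₀ os)) θ.τ9.M (k' + 1) X) cs.α₀ cs.α₁ →
            ∀ (Z : (domSys (F.P (ksel F θ g₀ os)) θ.τ9.M (k' + 1)).Dom), Z.1 ⊆ X.1 → ∀ t ∈ terms (L F θ (ksel F θ g₀ os)) θ.τ9.M Z,
              DifferentiableOn ℂ (fun z => TFc k' Z t z old φ) (D k') ∧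
                ∀ z ∈ D k', ‖TFc k' Z t z old φ‖ ≤ weight (L F θ (ksel F θ g₀ os)) θ.τ9.M (c F θ (ksel F θ g₀ os)) Z a t * Real.exp (a₅ * ((Z.1).card : ℝ))) ∧
        (∀ k' : ℕ, k' < ksel F θ g₀ os → ∀ i : ℕ, i < k' → ∀ (O : Set ℂ), IsOpen O → ∀ u ∈ D k', ∀ cv : ℂ → OlderTerms (F.P (ksel F θ g₀ os)) (MatA N) θ.τ9.M k',
          (∀ (j : Fin (k' + 1)) (Y : (domSys (F.P (ksel F θ g₀ os)) θ.τ9.M j).Dom) (ψ : CPair (F.P (ksel F θ g₀ os)) (MatA N)),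
              ψ ∈ spaceI Sg Rz θ.τ9.M j (domSites (F.P (ksel F θ g₀ os)) θ.τ9.M j Y) cs.α₀ cs.α₁ →
              DifferentiableOn ℂ (fun z => cv z j Y ψ) O ∧ ∀ z ∈ O, ‖cv z j Y ψ‖ ≤ E₀ * Real.exp (-((li F θ).κ * torusTreeLen Y.1))) →
          ∀ (X : (domSys (F.P (ksel F θ g₀ os)) θ.τ9.M (k' + 1)).Dom) (φ : CPair (F.P (ksel F θ g₀ os)) (MatA N)),
            φ ∈ spaceI Sg Rz θ.τ9.M (k' + 1) (domSites (F.P (ksel F θ g₀ os)) θ.τ9.M (k' + 1) X) cs.α₀ cs.α₁ →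
            ∀ (Z : (domSys (F.P (ksel F θ g₀ os)) θ.τ9.M (k' + 1)).Dom), Z.1 ⊆ X.1 → ∀ t ∈ terms (L F θ (ksel F θ g₀ os)) θ.τ9.M Z,
              DifferentiableOn ℂ (fun z => TFc k' Z t u (cv z) φ) O ∧
                ∀ z ∈ O, ‖TFc k' Z t u (cv z) φ‖ ≤ weight (L F θ (ksel F θ g₀ os)) θ.τ9.M (c F θ (ksel F θ g₀ os)) Z a t * Real.exp (a₅ * ((Z.1).card : ℝ))) ∧
        (∀ k' : ℕ, k' < ksel F θ g₀ os → ∀ (O : Set ℂ), IsOpen O → ∀ cv : ℂ → OlderTerms (F.P (ksel F θ g₀ os)) (MatA N) θ.τ9.M k',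
          (∀ (j : Fin (k' + 1)) (Y : (domSys (F.P (ksel F θ g₀ os)) θ.τ9.M j).Dom) (ψ : CPair (F.P (ksel F θ g₀ os)) (MatA N)),
              ψ ∈ spaceI Sg Rz θ.τ9.M j (domSites (F.P (ksel F θ g₀ os)) θ.τ9.M j Y) cs.α₀ cs.α₁ →
              DifferentiableOn ℂ (fun z => cv z j Y ψ) O ∧ ∀ z ∈ O, ‖cv z j Y ψ‖ ≤ E₀ * Real.exp (-((li F θ).κ * torusTreeLen Y.1))) →
          ∀ (X : (domSys (F.P (ksel F θ g₀ os)) θ.τ9.M (k' + 1)).Dom) (φ : CPair (F.P (ksel F θ g₀ os)) (MatA N)),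
            φ ∈ spaceI Sg Rz θ.τ9.M (k' + 1) (domSites (F.P (ksel F θ g₀ os)) θ.τ9.M (k' + 1) X) cs.α₀ cs.α₁ →
            ∀ (Z : (domSys (F.P (ksel F θ g₀ os)) θ.τ9.M (k' + 1)).Dom), Z.1 ⊆ X.1 → ∀ t ∈ terms (L F θ (ksel F θ g₀ os)) θ.τ9.M Z,
              DifferentiableOn ℂ (fun z => V k' Z t (cv z) φ) O ∧
                ∀ z ∈ O, ‖V k' Z t (cv z) φ‖ ≤ weight (L F θ (ksel F θ g₀ os)) θ.τ9.M (c F θ (ksel F θ g₀ os)) Z a t * Real.exp (a₅ * ((Z.1).card : ℝ))) ∧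
        (∀ k' : ℕ, k' < ksel F θ g₀ os → ∀ old : OlderTerms (F.P (ksel F θ g₀ os)) (MatA N) θ.τ9.M k',
          (∀ (j : Fin (k' + 1)) (Y : (domSys (F.P (ksel F θ g₀ os)) θ.τ9.M j).Dom) (ψ : CPair (F.P (ksel F θ g₀ os)) (MatA N)),
              ψ ∈ spaceI Sg Rz θ.τ9.M j (domSites (F.P (ksel F θ g₀ os)) θ.τ9.M j Y) cs.α₀ cs.α₁ → ‖old j Y ψ‖ ≤ E₀ * Real.exp (-((li F θ).κ * torusTreeLen Y.1))) →
          ∀ (X : (domSys (F.P (ksel F θ g₀ os)) θ.τ9.M (k' + 1)).Dom) (φ : CPair (F.P (ksel F θ g₀ os)) (MatA N)),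
            φ ∈ spaceI Sg Rz θ.τ9.M (k' + 1) (domSites (F.P (ksel F θ g₀ os)) θ.τ9.M (k' + 1) X) cs.α₀ cs.α₁ →
            ∀ (Z : (domSys (F.P (ksel F θ g₀ os)) θ.τ9.M (k' + 1)).Dom), Z.1 ⊆ X.1 → ∀ t ∈ terms (L F θ (ksel F θ g₀ os)) θ.τ9.M Z, ∀ z ∈ D k',
              ‖TFc k' Z t z old φ - V k' Z t old φ‖ ≤
                Mv * ‖z‖ ^ 2 * (weight (L F θ (ksel F θ g₀ os)) θ.τ9.M (c F θ (ksel F θ g₀ os)) Z a t * Real.exp (a₅ * ((Z.1).card : ℝ))))) :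
    ∀ (F : T4Family) (θ : Stage13Params F N) (hP : θ.Provisos₁₃Core F N), Rg F θ → θ.Admissible F N → ∀ (g₀ : ℕ → ℝ) (os : List (ULoop F)),
      N22At (rateCarriersOfRecord₁₃Co (readingOfRecord₁₃Co (fun F θ => ReadingData.ofRecordAdm F θ.τ9.M N (runTowers fun k => toClusterTower ((𝔇 F θ k).Gn₀)) (sp F θ)
        (gauge F θ) (hg F θ) (T₀ F θ) (hT F θ) (li F θ)) ℓ₃ ne2 ne1) F θ hP g₀ os (ksel F θ g₀ os)).u3 := by
  refine n22_tupleReadingOfRecordCoOn_relCentredTermDatum_of_n18Below (fun F θ k => (𝔇 F θ k).Gn₀) sp gauge hg T₀ hT li ℓ₃ ne2 ne1 ksel Rg (G := G) h18 hnum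
    fun F θ hP hRg hθ g₀ os => ?_
  obtain ⟨hMz, Sg, Rz, cs, a, a₂, a₂', a₅, a₅', Aabs, r₁, E₀, Mv, cA, TFc, V, D, hspk, hrest⟩ := hdata F θ hP hRg hθ g₀ os
  exact ⟨hMz, Sg, Rz, cs, c F θ (ksel F θ g₀ os), L F θ (ksel F θ g₀ os), hL F θ (ksel F θ g₀ os), a, a₂, a₂', a₅, a₅', Aabs, r₁, E₀, Mv, cA, 𝔇 F θ (ksel F θ g₀ os), TFc, V, D,
    TermData214.Gn₀_eq (𝔇 F θ (ksel F θ g₀ os)), hspk, hrest⟩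

open Classical in
/-- **… UNGUARDED** (the skeleton's binder verbatim; the guarded form at `Rg := fun _ _ ↦ True`).
[cite: Balaban1988RG2Cluster, (2.9)-(2.15) pp.14-16, (2.26) p.17, Lemma 3 p.20 and (2.39)-(2.41) p.21; Balaban1987RG1, (0.23)-(0.25) pp.256-257, §1 p.263 and (2.13) p.268] -/
theorem n22_tupleReadingOfRecordCo_relCentredTermDatum₀_of_n18Below
    (h18 : ∀ (F : T4Family) (θ : Stage13Params F N) (hP : θ.Provisos₁₃Core F N), θ.Admissible F N → ∀ (g₀ : ℕ → ℝ) (os : List (ULoop F)),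
      ∀ k' : ℕ, k' < ksel F θ g₀ os → N18At (u3OfRecord₁₃ θ ((ReadingData.ofRecordAdm F θ.τ9.M N (runTowers fun k => toClusterTower ((𝔇 F θ k).Gn₀)) (sp F θ)
        (gauge F θ) (hg F θ) (T₀ F θ) (hT F θ) (li F θ)).u3Objects θ.γ) k'))
    (hnum : ∀ (F : T4Family) (θ : Stage13Params F N), θ.Provisos₁₃Core F N → θ.Admissible F N →
      0 < (li F θ).C₀ ∧ 0 < (li F θ).θ₅ ∧ (li F θ).θ₅ < 1 ∧ 0 ≤ (li F θ).C₅ ∧ 2 * (li F θ).C₅ / (1 - (li F θ).θ₅) ≤ (li F θ).C₀ ∧ 0 < (li F θ).A ∧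
        (li F θ).μ = 1 ∧ 0 < (li F θ).r ∧ (li F θ).s = (2 : ℝ)⁻¹)
    (hdata : ∀ (F : T4Family) (θ : Stage13Params F N), θ.Provisos₁₃Core F N → θ.Admissible F N → ∀ (g₀ : ℕ → ℝ) (os : List (ULoop F)),
      ∃ (_ : NeZero θ.τ9.M) (Sg : Setting (MatA N) G) (Rz : Residual (F.P (ksel F θ g₀ os)) (MatA N))
        (cs : SFConsts) (a a₂ a₂' a₅ a₅' Aabs r₁ E₀ Mv cA : ℝ) (TFc : GenTermFun (F.P (ksel F θ g₀ os)) (MatA N) θ.τ9.M (L F θ (ksel F θ g₀ os)))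
        (V : (k' : ℕ) → (domSys (F.P (ksel F θ g₀ os)) θ.τ9.M (k' + 1)).Dom → TermLabel (F.P (ksel F θ g₀ os)) θ.τ9.M k' (L F θ (ksel F θ g₀ os)) →
          OlderTerms (F.P (ksel F θ g₀ os)) (MatA N) θ.τ9.M k' → CPair (F.P (ksel F θ g₀ os)) (MatA N) → ℂ)
        (D : ℕ → Set ℂ),
        (∀ (j : ℕ) (Y : (domSys (F.P (ksel F θ g₀ os)) θ.τ9.M j).Dom),
          sp F θ (ksel F θ g₀ os) j Y ⊆ spaceI Sg Rz θ.τ9.M j (domSites (F.P (ksel F θ g₀ os)) θ.τ9.M j Y) cs.α₀ cs.α₁) ∧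
        8 ≤ (c F θ (ksel F θ g₀ os)).L ∧ (c F θ (ksel F θ g₀ os)).L = L F θ (ksel F θ g₀ os) ∧
        Lemma3Numerics (c F θ (ksel F θ g₀ os)) θ.τ9.M (((c F θ (ksel F θ g₀ os)).L : ℝ) / 2) a a₂ a₂' a₅' Aabs ∧
        0 ≤ (c F θ (ksel F θ g₀ os)).C3act * (c F θ (ksel F θ g₀ os)).ε₁ ∧ 0 ≤ r₁ ∧ (li F θ).κ ≤ r₁ ∧
        r₁ + 2 * (64 * Real.log 162) + 2 ≤ (1 - 8 * (c F θ (ksel F θ g₀ os)).δ) * (((c F θ (ksel F θ g₀ os)).L : ℝ) / 2) * (c F θ (ksel F θ g₀ os)).κ ∧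
        (c F θ (ksel F θ g₀ os)).C3act * (c F θ (ksel F θ g₀ os)).ε₁ * Real.exp (5 * r₁ + 1) * K₀ 64 8 * 9 * 64 ≤ 1 ∧
        Real.exp 1 * 9 * 64 * K₀ 64 8 ^ 2 * ((c F θ (ksel F θ g₀ os)).C3act * (c F θ (ksel F θ g₀ os)).ε₁) ≤ E₀ ∧
        (∀ (k' : ℕ) (Z : (domSys (F.P (ksel F θ g₀ os)) θ.τ9.M (k' + 1)).Dom), 2 * Real.exp (a₅ * ((Z.1).card : ℝ)) ≤ Real.exp (a₅' * ((Z.1).card : ℝ))) ∧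
        (∀ i, IsOpen (D i)) ∧ (∀ (i : ℕ), ∀ t ∈ Ioc (0 : ℝ) θ.γ, ((t : ℝ) : ℂ) ∈ D i) ∧ (∀ (i : ℕ), ∀ t ∈ Ioc (0 : ℝ) θ.γ, closedBall (t : ℂ) (cA * t) ⊆ D i) ∧
        0 < cA ∧ cA < 1 ∧ 0 < Mv ∧ Mv * ((1 + cA) * θ.γ) ^ 2 ≤ 1 / 2 ∧ 2 * Mv * E₀ * (1 + cA) ^ 2 ≤ (li F θ).A ∧ (li F θ).r ≤ min cA 1 ∧
        (∀ (k' : ℕ) (Z : (domSys (F.P (ksel F θ g₀ os)) θ.τ9.M (k' + 1)).Dom) (t : TermLabel (F.P (ksel F θ g₀ os)) θ.τ9.M k' (L F θ (ksel F θ g₀ os))) (s : ℝ),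
          s ∈ Ioc (0 : ℝ) θ.γ → ∀ (old : OlderTerms (F.P (ksel F θ g₀ os)) (MatA N) θ.τ9.M k') (φ : CPair (F.P (ksel F θ g₀ os)) (MatA N)),
            TFc k' Z t (s : ℂ) old φ = (𝔇 F θ (ksel F θ g₀ os) k').TF Z t (s : ℂ) old φ) ∧
        (∀ k' : ℕ, k' < ksel F θ g₀ os → ∀ old : OlderTerms (F.P (ksel F θ g₀ os)) (MatA N) θ.τ9.M k',
          (∀ (j : Fin (k' + 1)) (Y : (domSys (F.P (ksel F θ g₀ os)) θ.τ9.M j).Dom) (ψ : CPair (F.P (ksel F θ g₀ os)) (MatA N)),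
              ψ ∈ spaceI Sg Rz θ.τ9.M j (domSites (F.P (ksel F θ g₀ os)) θ.τ9.M j Y) cs.α₀ cs.α₁ → ‖old j Y ψ‖ ≤ E₀ * Real.exp (-((li F θ).κ * torusTreeLen Y.1))) →
          ∀ (X : (domSys (F.P (ksel F θ g₀ os)) θ.τ9.M (k' + 1)).Dom) (φ : CPair (F.P (ksel F θ g₀ os)) (MatA N)),
            φ ∈ spaceI Sg Rz θ.τ9.M (k' + 1) (domSites (F.P (ksel F θ g₀ os)) θ.τ9.M (k' + 1) X) cs.α₀ cs.α₁ →
            ∀ (Z : (domSys (F.P (ksel F θ g₀ os)) θ.τ9.M (k' + 1)).Dom), Z.1 ⊆ X.1 → ∀ t ∈ terms (L F θ (ksel F θ g₀ os)) θ.τ9.M Z,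
              DifferentiableOn ℂ (fun z => TFc k' Z t z old φ) (D k') ∧
                ∀ z ∈ D k', ‖TFc k' Z t z old φ‖ ≤ weight (L F θ (ksel F θ g₀ os)) θ.τ9.M (c F θ (ksel F θ g₀ os)) Z a t * Real.exp (a₅ * ((Z.1).card : ℝ))) ∧
        (∀ k' : ℕ, k' < ksel F θ g₀ os → ∀ i : ℕ, i < k' → ∀ (O : Set ℂ), IsOpen O → ∀ u ∈ D k', ∀ cv : ℂ → OlderTerms (F.P (ksel F θ g₀ os)) (MatA N) θ.τ9.M k',
          (∀ (j : Fin (k' + 1)) (Y : (domSys (F.P (ksel F θ g₀ os)) θ.τ9.M j).Dom) (ψ : CPair (F.P (ksel F θ g₀ os)) (MatA N)),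
              ψ ∈ spaceI Sg Rz θ.τ9.M j (domSites (F.P (ksel F θ g₀ os)) θ.τ9.M j Y) cs.α₀ cs.α₁ →
              DifferentiableOn ℂ (fun z => cv z j Y ψ) O ∧ ∀ z ∈ O, ‖cv z j Y ψ‖ ≤ E₀ * Real.exp (-((li F θ).κ * torusTreeLen Y.1))) →
          ∀ (X : (domSys (F.P (ksel F θ g₀ os)) θ.τ9.M (k' + 1)).Dom) (φ : CPair (F.P (ksel F θ g₀ os)) (MatA N)),
            φ ∈ spaceI Sg Rz θ.τ9.M (k' + 1) (domSites (F.P (ksel F θ g₀ os)) θ.τ9.M (k' + 1) X) cs.α₀ cs.α₁ →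
            ∀ (Z : (domSys (F.P (ksel F θ g₀ os)) θ.τ9.M (k' + 1)).Dom), Z.1 ⊆ X.1 → ∀ t ∈ terms (L F θ (ksel F θ g₀ os)) θ.τ9.M Z,
              DifferentiableOn ℂ (fun z => TFc k' Z t u (cv z) φ) O ∧
                ∀ z ∈ O, ‖TFc k' Z t u (cv z) φ‖ ≤ weight (L F θ (ksel F θ g₀ os)) θ.τ9.M (c F θ (ksel F θ g₀ os)) Z a t * Real.exp (a₅ * ((Z.1).card : ℝ))) ∧
        (∀ k' : ℕ, k' < ksel F θ g₀ os → ∀ (O : Set ℂ), IsOpen O → ∀ cv : ℂ → OlderTerms (F.P (ksel F θ g₀ os)) (MatA N) θ.τ9.M k',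
          (∀ (j : Fin (k' + 1)) (Y : (domSys (F.P (ksel F θ g₀ os)) θ.τ9.M j).Dom) (ψ : CPair (F.P (ksel F θ g₀ os)) (MatA N)),
              ψ ∈ spaceI Sg Rz θ.τ9.M j (domSites (F.P (ksel F θ g₀ os)) θ.τ9.M j Y) cs.α₀ cs.α₁ →
              DifferentiableOn ℂ (fun z => cv z j Y ψ) O ∧ ∀ z ∈ O, ‖cv z j Y ψ‖ ≤ E₀ * Real.exp (-((li F θ).κ * torusTreeLen Y.1))) →
          ∀ (X : (domSys (F.P (ksel F θ g₀ os)) θ.τ9.M (k' + 1)).Dom) (φ : CPair (F.P (ksel F θ g₀ os)) (MatA N)),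
            φ ∈ spaceI Sg Rz θ.τ9.M (k' + 1) (domSites (F.P (ksel F θ g₀ os)) θ.τ9.M (k' + 1) X) cs.α₀ cs.α₁ →
            ∀ (Z : (domSys (F.P (ksel F θ g₀ os)) θ.τ9.M (k' + 1)).Dom), Z.1 ⊆ X.1 → ∀ t ∈ terms (L F θ (ksel F θ g₀ os)) θ.τ9.M Z,
              DifferentiableOn ℂ (fun z => V k' Z t (cv z) φ) O ∧
                ∀ z ∈ O, ‖V k' Z t (cv z) φ‖ ≤ weight (L F θ (ksel F θ g₀ os)) θ.τ9.M (c F θ (ksel F θ g₀ os)) Z a t * Real.exp (a₅ * ((Z.1).card : ℝ))) ∧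
        (∀ k' : ℕ, k' < ksel F θ g₀ os → ∀ old : OlderTerms (F.P (ksel F θ g₀ os)) (MatA N) θ.τ9.M k',
          (∀ (j : Fin (k' + 1)) (Y : (domSys (F.P (ksel F θ g₀ os)) θ.τ9.M j).Dom) (ψ : CPair (F.P (ksel F θ g₀ os)) (MatA N)),
              ψ ∈ spaceI Sg Rz θ.τ9.M j (domSites (F.P (ksel F θ g₀ os)) θ.τ9.M j Y) cs.α₀ cs.α₁ → ‖old j Y ψ‖ ≤ E₀ * Real.exp (-((li F θ).κ * torusTreeLen Y.1))) →
          ∀ (X : (domSys (F.P (ksel F θ g₀ os)) θ.τ9.M (k' + 1)).Dom) (φ : CPair (F.P (ksel F θ g₀ os)) (MatA N)),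
            φ ∈ spaceI Sg Rz θ.τ9.M (k' + 1) (domSites (F.P (ksel F θ g₀ os)) θ.τ9.M (k' + 1) X) cs.α₀ cs.α₁ →
            ∀ (Z : (domSys (F.P (ksel F θ g₀ os)) θ.τ9.M (k' + 1)).Dom), Z.1 ⊆ X.1 → ∀ t ∈ terms (L F θ (ksel F θ g₀ os)) θ.τ9.M Z, ∀ z ∈ D k',
              ‖TFc k' Z t z old φ - V k' Z t old φ‖ ≤
                Mv * ‖z‖ ^ 2 * (weight (L F θ (ksel F θ g₀ os)) θ.τ9.M (c F θ (ksel F θ g₀ os)) Z a t * Real.exp (a₅ * ((Z.1).card : ℝ))))) :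
    ∀ (F : T4Family) (θ : Stage13Params F N) (hP : θ.Provisos₁₃Core F N), θ.Admissible F N → ∀ (g₀ : ℕ → ℝ) (os : List (ULoop F)),
      N22At (rateCarriersOfRecord₁₃Co (readingOfRecord₁₃Co (fun F θ => ReadingData.ofRecordAdm F θ.τ9.M N (runTowers fun k => toClusterTower ((𝔇 F θ k).Gn₀)) (sp F θ)
        (gauge F θ) (hg F θ) (T₀ F θ) (hT F θ) (li F θ)) ℓ₃ ne2 ne1) F θ hP g₀ os (ksel F θ g₀ os)).u3 :=
  fun F θ hP hθ g₀ os =>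
    n22_tupleReadingOfRecordCoOn_relCentredTermDatum₀_of_n18Below c L 𝔇 sp gauge hg T₀ hT li ℓ₃ ne2 ne1 ksel (fun _ _ => True) (G := G)
      (fun F θ hP _ hθ => h18 F θ hP hθ) (fun F θ hP _ hθ => hnum F θ hP hθ) (fun F θ hP _ hθ => hdata F θ hP hθ) F θ hP trivial hθ g₀ os

end Generated

end YMDAG.N22.W1

end
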